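import Summits.AtomisticToContinuum.Crystallization.Theses.HullExactificationCascade
import Summits.AtomisticToContinuum.Crystallization.Theorems.HullExactificationCascadeHullExactShellsLimits
import Summits.AtomisticToContinuum.Crystallization.Theorems.HullExactificationCascadeHullExactShellsShells

/-!
# `HullExactShells` (route `HullExactificationCascade`, support F,
# item stmt-AtomisticToContinuum-12092)

EXACTIFICATION no. 2, inside the hull.  Let `x` be a family of finite configurations of `ℝ³`
(Lennard-Jones ground states in the item; not used), `a > 0`, `h`, `δ > 0`, and `S ⊆ ℝ³` a
`δ`-separated, relatively dense local limit of translates of `x` such that for EVERY `η > 0` the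
`η`-bad points of `S` — those whose punctured open `13/10·a`-shell is not `η`-congruent (linear
isometry + bijection) to the punctured `13/10·a`-shell `P` of `hcpStacking a h` at `0` — have
density zero uniformly over balls.  Then some `δ`-separated local limit `S₂ ∋ 0` of translates of
`x` has ALL its points `η`-good for every `η > 0`.

Proof (`hullExactShells_proof`):
1. defect-free balls (`exists_ball_forall_not`, grid/pigeonhole) and relative denseness give
   `y_n ∈ S` such that every point of `S` within `n` of `y_n` is `1/(n+1)`-good;
2. the recentred sets `X_n := S - y_n ∋ 0` are `δ`-separated, so a subsequence converges locally
   (`exists_subseq_forall_eventually_ballMatch`, `LocalMatchingCompactness.lean`) to a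
   `δ`-separated `S₂`, which contains `0` (`zero_mem_of_ballMatch`);
3. `S₂` is a local limit of translates of `x`: each `X_n` is (`isLimit_preimage_add_const`) and
   local limits of local limits are local limits (`isLimit_of_eventually_ballMatch`, diagonal);
4. goodness passes to the limit (`good_of_limit`): near any `y ∈ S₂` the approximating sets have
   `η`-good shells for every `η` eventually (`good_preimage_add_const` for the recentring), and a
   fine matching restricts to a bijection of shells.

Sources: Radin 1991 §2–3 (ground-state hull); Baake–Grimm 2013, Remark 5.6 (local rubber
topology); Blanc–Lewin 2015 §2.1 (16).  All steps `[folklore]`.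
-/

noncomputable section

namespace Summit.AtomisticToContinuum.Crystallization.Theorems.HullExactShells

open scoped Topology
open Filter Set Metric
open Literature.MathematicalPhysics.StatisticalMechanics

/-- **Support F `HullExactShells`** of route `HullExactificationCascade`
(item stmt-AtomisticToContinuum-12092): a `δ`-separated, relatively dense hull element `S` of
`x` whose `η`-bad points have density zero uniformly over balls for every `η > 0` yields a hull
element `S₂ ∋ 0`, `δ`-separated, every point of which is `η`-good for every `η > 0`. [folklore] -/
theorem hullExactShells_proof :
    Summit.AtomisticToContinuum.Crystallization.Theses.HullExactificationCascade.HullExactShells := by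
  intro x _hx a h S δ hδ ha hsep hlimS hdense hdens
  classical
  have hr : (0 : ℝ) < 13 / 10 * a := by positivity
  obtain ⟨R₁, hR₁⟩ := hdense
  have hR₁0 : 0 ≤ R₁ := by
    obtain ⟨y, -, hy⟩ := hR₁ 0
    exact dist_nonneg.trans hy
  -- Step 1: good balls around points of `S`
  have hA : ∀ n : ℕ, ∃ y ∈ S, ∀ z ∈ S, dist z y ≤ n →
      ∃ A : EuclideanSpace ℝ (Fin 3) →ₗᵢ[ℝ] EuclideanSpace ℝ (Fin 3),
        ∃ e : ↥{w | w ∈ S ∧ w ≠ z ∧ dist w z < 13 / 10 * a} ≃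
          ↥{p : EuclideanSpace ℝ (Fin 3) | p ∈ hcpStacking a h ∧ p ≠ 0 ∧ ‖p‖ < 13 / 10 * a},
          ∀ t : ↥{w | w ∈ S ∧ w ≠ z ∧ dist w z < 13 / 10 * a},
            dist ((t : EuclideanSpace ℝ (Fin 3)) - z)
              (A ((e t : ↥{p : EuclideanSpace ℝ (Fin 3) |
                p ∈ hcpStacking a h ∧ p ≠ 0 ∧ ‖p‖ < 13 / 10 * a}) : EuclideanSpace ℝ (Fin 3))) ≤
              1 / ((n : ℝ) + 1) := by
    intro n
    have hbad := hdens (1 / ((n : ℝ) + 1)) (by positivity)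
    obtain ⟨c, hc⟩ := exists_ball_forall_not hδ hsep
      (bad := fun z => ¬ ∃ A : EuclideanSpace ℝ (Fin 3) →ₗᵢ[ℝ] EuclideanSpace ℝ (Fin 3),
        ∃ e : ↥{w | w ∈ S ∧ w ≠ z ∧ dist w z < 13 / 10 * a} ≃
          ↥{p : EuclideanSpace ℝ (Fin 3) | p ∈ hcpStacking a h ∧ p ≠ 0 ∧ ‖p‖ < 13 / 10 * a},
          ∀ t : ↥{w | w ∈ S ∧ w ≠ z ∧ dist w z < 13 / 10 * a},
            dist ((t : EuclideanSpace ℝ (Fin 3)) - z)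
              (A ((e t : ↥{p : EuclideanSpace ℝ (Fin 3) |
                p ∈ hcpStacking a h ∧ p ≠ 0 ∧ ‖p‖ < 13 / 10 * a}) : EuclideanSpace ℝ (Fin 3))) ≤
              1 / ((n : ℝ) + 1))
      (fun θ hθ => (hbad θ hθ).imp fun L₀ hL₀ L hL => hL₀ L hL 0)
      (r := n + R₁ + 1) (by have := Nat.cast_nonneg (α := ℝ) n; linarith)
    obtain ⟨y, hyS, hyc⟩ := hR₁ c
    refine ⟨y, hyS, fun z hz hzy => not_not.1 (hc z hz ?_)⟩
    linarith [dist_triangle z y c]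
  choose yc hycS hgood using hA
  -- Step 2: recentre (`X n := S - yc n ∋ 0`) and extract a locally convergent subsequence
  obtain ⟨Xs, hXs⟩ : ∃ Xs : ℕ → Set (EuclideanSpace ℝ (Fin 3)),
      ∀ n, Xs n = (fun p => p + yc n) ⁻¹' S := ⟨_, fun n => rfl⟩
  have hsepX : ∀ n, ∀ p ∈ Xs n, ∀ q ∈ Xs n, p ≠ q → δ ≤ dist p q := fun n => by
    rw [hXs n]; exact sep_preimage_add_const hsep (yc n)
  have h0X : ∀ n, (0 : EuclideanSpace ℝ (Fin 3)) ∈ Xs n := fun n => by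
    rw [hXs n]
    show (0 : EuclideanSpace ℝ (Fin 3)) + yc n ∈ S
    rw [zero_add]; exact hycS n
  obtain ⟨ψ, S₂, hψ, hsep₂, hlim₂⟩ := exists_subseq_forall_eventually_ballMatch hδ Xs hsepX
  refine ⟨S₂, hsep₂, ?_, ?_, ?_⟩
  · -- `0 ∈ S₂`
    exact zero_mem_of_ballMatch (T := fun k => Xs (ψ k)) hδ hsep₂
      (Eventually.of_forall fun k => h0X (ψ k)) hlim₂
  · -- Step 3: `S₂` is a local limit of translates of `x`
    refine isLimit_of_eventually_ballMatch (Xs := fun k => Xs (ψ k)) (fun k => ?_) hlim₂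
    rw [hXs (ψ k)]
    exact isLimit_preimage_add_const hlimS (yc (ψ k))
  · -- Step 4: every point of `S₂` is `η`-good for every `η > 0`
    intro y hy η hη
    dsimp only
    refine good_of_limit (Xs := fun k => Xs (ψ k)) hδ hr (fun p hp => hp.2.2)
      (fun k => hsepX (ψ k)) hsep₂ hlim₂ hy (fun η' hη' => ?_) hη
    filter_upwards [Filter.eventually_ge_atTop ⌈max (‖y‖ + 1) (1 / η')⌉₊] with k hk z hz hzn
    have hk' : max (‖y‖ + 1) (1 / η') ≤ (ψ k : ℝ) :=
      (Nat.le_ceil _).trans (by exact_mod_cast hk.trans hψ.le_apply)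
    have hkR : ‖y‖ + 1 ≤ (ψ k : ℝ) := (le_max_left _ _).trans hk'
    have hkη : 1 / ((ψ k : ℝ) + 1) ≤ η' := by
      have h1 : 1 / η' ≤ (ψ k : ℝ) := (le_max_right _ _).trans hk'
      rw [div_le_iff₀ hη'] at h1
      rw [div_le_iff₀ (by positivity)]
      nlinarith
    have hz' : z ∈ (fun p => p + yc (ψ k)) ⁻¹' S := by rw [← hXs (ψ k)]; exact hz
    have hzS : z + yc (ψ k) ∈ S := hz'
    have hzd : dist (z + yc (ψ k)) (yc (ψ k)) ≤ (ψ k : ℝ) := by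
      rw [dist_eq_norm, add_sub_cancel_right]; linarith
    obtain ⟨A, e, he⟩ := hgood (ψ k) (z + yc (ψ k)) hzS hzd
    have hg' := good_preimage_add_const (X := S) (z := z) (yc (ψ k))
      ⟨A, e, fun t => (he t).trans hkη⟩
    rw [← hXs (ψ k)] at hg'
    exact hg'

end Summit.AtomisticToContinuum.Crystallization.Theorems.HullExactShells

end
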